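import Summits.QuantumFields.YangMills.Theses.UnitScaleTilt
import Literature.MathematicalPhysics.QuantumFieldTheory.Balaban1983to89.T3AlphaInputsACSchemas

/-!
# Route `UnitScaleTilt` — crux K2 `HistoryTail` (stmt-QuantumFields-18916): A FREE DIAL OF THE (α) PACKAGE `AlphaInputsT3ACFull` v1.1 —
# the large-field term `Zterm` of (41) can be SHIFTED by any non-negative `T(K, j)` without leaving the package, while the majorant `up_D`
# scales by `e^{T}`; hence every decoupling bound proved for ALL package data self-improves by arbitrary factors `e^{−T(K, j)}` (support file;
# kernel form of the lead finding F-g2-1 §F1 (E1), evidence #22 on the item)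

Fleet lead `ym-ust-18916-p1` (gen 2), 2026-08-26.  The owner's v5 text for `stub_decoupling` (ruling g15-№2 (iv)) quantifies «∀ D W C68 Cχ B₃,
`T3AlphaInputsACSchemas.AlphaInputsT3ACFull D W b₀ p₀ ε₀ C68 Cχ B₃` → `∫_{E′(p)} up_D ≤ C·β^A·e^{−¼p² + κx^{2+3r₀}}·∫ low_D`».  THIS FILE proves, sorry-free
and over the interface as landed (p456617/p456879):

* §1 `up_zshift`/`low_zshift`: for the datum `D⁺ := {D with Zterm := Zterm + T(K, j)}` (the opened history functional `W` carried along
  unchanged), `up_{D⁺} = e^{T}·up_D` (by `lf_shift_of_LFSum`) and `low_{D⁺} = low_D`;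
* §2 **`alphaInputsT3ACFull_zshift`**: if `0 ≤ T` then `AlphaInputsT3ACFull D W …` ⟹ `AlphaInputsT3ACFull D⁺ W⁺ …` with THE SAME constants —
  every clause of the package either does not read `Zterm` (all the locality / size / anti-junk / (42) / (68) / `LFSum` / `LargePSpec` /
  `NoTrivOnLarge` / `SmallFactor71` clauses, `Ineq47AE`, `RepAtHeights`) or reads `up` only from below (`Ineq41AE`, and `EnvelopeRegular`'s
  integrability): (41) p.266 has NO printed size for «Σ_{j<k} O(log g_j⁻¹)|Z_j|» among the typed schemas;
* §3 **`numeratorBound_selfImproves`**: consequently ANY numerator bound `∫_{E} up ≤ B(K, j)·∫ low` established for ALL package data at fixed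
  `(b₀, p₀, ε₀, C68, Cχ, B₃)` holds for all package data with `B(K, j)` replaced by `e^{−T(K, j)}·B(K, j)`, for every non-negative `T` — e.g.
  `T(K, j) = k·p(g_{K−j})²`: the ∀-form of the decoupling stub would prove a super-Gaussian large-plaquette tail `e^{−(k+¼)p²}` for every `k`
  (modulo (α)), which is not in print ((71) p.273 gives `e^{−¼p²}`) and not believed; so the stub is unprovable from the clauses as they stand,
  and the package needs the size clause `ZtermSize` (and its companions `TrivTerm`/`WtAdm`, F-g2-1 §F4) before S5 is registered over abstract data.

WHAT THIS IS NOT: no claim that the package is inconsistent or that Bałaban's data violate anything — the shift produces a DIFFERENT, junk-enlarged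
datum that the v1.1 clauses cannot tell apart from an honest one.  No new definition (the shifted datum is written as a structure update inline).

References: T. Bałaban, CMP 102 (1985) 255–275 [Balaban1985UV3] ((41) p.266, (47) p.267, (71) p.273).
-/

noncomputable section

open MeasureTheory
open Literature.MathematicalPhysics.QuantumFieldTheory.Balaban1983to89
open Literature.MathematicalPhysics.QuantumFieldTheory.Balaban1983to89.T3ContinuumYM3Torus
open Literature.MathematicalPhysics.QuantumFieldTheory.Balaban1983to89.T3UnitScaleTilt
open Literature.MathematicalPhysics.QuantumFieldTheory.Balaban1983to89.T3UnitLawDensityEML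
open Literature.MathematicalPhysics.QuantumFieldTheory.Balaban1983to89.T3RestrictedUnitDensity
open Literature.MathematicalPhysics.QuantumFieldTheory.Balaban1983to89.T3AlphaInputsAC
open Literature.MathematicalPhysics.QuantumFieldTheory.Balaban1983to89.T3AlphaInputsACSchemas

namespace Summit.QuantumFields.YangMills.Theorems.HistoryTailAlphaFreeDial

variable {F : T3Family} {γ : ℝ}

/-! ## §1 The shifted datum: `up` scales by `e^{T}`, `low` is unchanged -/

/-- Under `LFSum`, shifting the large-field term `Zterm` of (41) by a history-independent `T(K, j)` multiplies the majorant `up` by `e^{T(K, j)}`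
(`lf_shift_of_LFSum`). [cite: Balaban1985UV3, (41) p.266] -/
theorem up_zshift (D : AlphaDataT3 F γ) (W : LFData D) (hLF : LFSum D W) (T : ℕ → ℕ → ℝ) (K j : ℕ)
    (Wf : GaugeField (F.P K) j (Matrix.specialUnitaryGroup (Fin 2) ℂ)) :
    AlphaDataT3.up ({ D with Zterm := fun K j h => D.Zterm K j h + T K j } : AlphaDataT3 F γ) K j Wf = Real.exp (T K j) * D.up K j Wf := by
  have h := lf_shift_of_LFSum hLF K j Wf (fun h => -(D.mainT K j h Wf) + D.Pint K j h Wf + D.Zterm K j h) (T K j)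
  have hfun : (fun h : D.Hist K j => -(D.mainT K j h Wf) + D.Pint K j h Wf + (D.Zterm K j h + T K j)) =
      fun h => -(D.mainT K j h Wf) + D.Pint K j h Wf + D.Zterm K j h + T K j := by
    funext h; ring
  show D.LF K j Wf (fun h => -(D.mainT K j h Wf) + D.Pint K j h Wf + (D.Zterm K j h + T K j)) =
    Real.exp (T K j) * D.LF K j Wf (fun h => -(D.mainT K j h Wf) + D.Pint K j h Wf + D.Zterm K j h)
  rw [hfun]
  exact h

/-- The minorant `low` of (47) does not read `Zterm` (definitional). [cite: Balaban1985UV3, (47) p.267] -/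
theorem low_zshift (D : AlphaDataT3 F γ) (T : ℕ → ℕ → ℝ) (K j : ℕ)
    (Wf : GaugeField (F.P K) j (Matrix.specialUnitaryGroup (Fin 2) ℂ)) :
    AlphaDataT3.low ({ D with Zterm := fun K j h => D.Zterm K j h + T K j } : AlphaDataT3 F γ) K j Wf = D.low K j Wf := rfl

/-- `up` of the shifted datum as a function: `e^{T}·up`. [cite: Balaban1985UV3, (41) p.266] -/
theorem up_zshift_eq (D : AlphaDataT3 F γ) (W : LFData D) (hLF : LFSum D W) (T : ℕ → ℕ → ℝ) (K j : ℕ) :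
    AlphaDataT3.up ({ D with Zterm := fun K j h => D.Zterm K j h + T K j } : AlphaDataT3 F γ) K j = fun Wf => Real.exp (T K j) * D.up K j Wf :=
  funext fun Wf => up_zshift D W hLF T K j Wf

/-! ## §2 The package is blind to the shift -/

/-- **THE v1.1 PACKAGE `AlphaInputsT3AC` SURVIVES ANY NON-NEGATIVE `Zterm` SHIFT** (given `LFSum` for the shift law of `up`): all clauses but
(41′)/regularity do not read `Zterm`; (41′) a.e. only gets easier (`up ≥ 0` a.e., `e^{T} ≥ 1`); integrability of `e^{T}·up` is that of `up`.
[cite: Balaban1985UV3, (41) p.266 and (47) p.267] -/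
theorem alphaInputsT3AC_zshift {D : AlphaDataT3 F γ} (W : LFData D) (hLF : LFSum D W) {b₀ p₀ ε₀ C68 : ℝ}
    (h : T3AlphaInputsACSchemas.AlphaInputsT3AC D b₀ p₀ ε₀ C68) (T : ℕ → ℕ → ℝ) (hT : ∀ K j, 0 ≤ T K j) :
    T3AlphaInputsACSchemas.AlphaInputsT3AC ({ D with Zterm := fun K j h => D.Zterm K j h + T K j } : AlphaDataT3 F γ) b₀ p₀ ε₀ C68 := by
  obtain ⟨hloc, hsizes, hχ, henv, hrep, hmin, hanti⟩ := h
  refine ⟨hloc, hsizes, hχ, fun K j hj => ?_, hrep, hmin, hanti⟩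
  obtain ⟨h41, h47, hlowI, hupI, hpos⟩ := henv K j hj
  have hup0 := T3AlphaInputsAC.up_nonneg_ae hχ h41 h47
  refine ⟨?_, h47, hlowI, ?_, hpos⟩
  · -- (41′) a.e. for the shifted datum
    show ∀ᵐ W' ∂fieldMeasure (F.P K) j (Matrix.specialUnitaryGroup (Fin 2) ℂ),
      resDensity F γ K Set.univ j W' ≤ Real.exp (-(D.Ecst K j) + D.Rm K j) *
        AlphaDataT3.up ({ D with Zterm := fun K j h => D.Zterm K j h + T K j } : AlphaDataT3 F γ) K j W'
    filter_upwards [h41, hup0] with W' h1 h0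
    rw [up_zshift D W hLF T K j W']
    refine h1.trans (mul_le_mul_of_nonneg_left ?_ (Real.exp_nonneg _))
    have h1T : 1 ≤ Real.exp (T K j) := Real.one_le_exp (hT K j)
    nlinarith
  · -- integrability of `e^{T}·up`
    show Integrable (AlphaDataT3.up ({ D with Zterm := fun K j h => D.Zterm K j h + T K j } : AlphaDataT3 F γ) K j)
      (fieldMeasure (F.P K) j (Matrix.specialUnitaryGroup (Fin 2) ℂ))
    rw [up_zshift_eq D W hLF T K j]
    exact hupI.const_mul _

/-- **THE FULL PACKAGE `AlphaInputsT3ACFull` SURVIVES ANY NON-NEGATIVE `Zterm` SHIFT**, with the opened history functional carried along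
unchanged (`Reg`, `trivReg`, `assemble`, `wt`, `LargeP` the same data) and THE SAME constants `(b₀, p₀, ε₀, C68, Cχ, B₃)`: none of `LFSum`,
`LargePSpec`, `NoTrivOnLarge`, `SmallFactor71` reads `Zterm`.  The free dial E1 of finding F-g2-1. [cite: Balaban1985UV3, (41) p.266] -/
theorem alphaInputsT3ACFull_zshift {D : AlphaDataT3 F γ} {W : LFData D} {b₀ p₀ ε₀ C68 Cχ B₃ : ℝ}
    (h : AlphaInputsT3ACFull D W b₀ p₀ ε₀ C68 Cχ B₃) (T : ℕ → ℕ → ℝ) (hT : ∀ K j, 0 ≤ T K j) :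
    AlphaInputsT3ACFull ({ D with Zterm := fun K j h => D.Zterm K j h + T K j } : AlphaDataT3 F γ)
      (⟨W.Reg, W.regFintype, W.trivReg, W.assemble, W.wt, W.LargeP⟩ :
        LFData ({ D with Zterm := fun K j h => D.Zterm K j h + T K j } : AlphaDataT3 F γ)) b₀ p₀ ε₀ C68 Cχ B₃ := by
  obtain ⟨hpack, hLF, hLP, hNT, hSF⟩ := h
  exact ⟨alphaInputsT3AC_zshift W hLF hpack T hT, hLF, hLP, hNT, hSF⟩

/-! ## §3 Every numerator bound over ALL package data self-improves by arbitrary factors `e^{−T(K, j)}` -/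

/-- **SELF-IMPROVEMENT OF ∀-FORM NUMERATOR BOUNDS** (the kernel form of F-g2-1 §F1): fix `(b₀, p₀, ε₀, C68, Cχ, B₃)` and an event family
`E K j p`.  If EVERY pair `(D, W)` with `AlphaInputsT3ACFull D W …` admits heights/constants `(j₀, C, A)` with
`∫_{E} up_D(K, j) ≤ C·β_{K−j}^A·B(K, j)·∫ low_D(K, j)` (`j₀ < j ≤ K`), then for every non-negative `T` every such pair also admits `(j₀, C, A)` with the
bound IMPROVED to `C·β^A·(e^{−T(K, j)}·B(K, j))` — apply the hypothesis to the `Zterm`-shifted datum and divide by `e^{T}`.  With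
`T(K, j) = k·p(g_{K−j})²` this turns the decoupling stub's `e^{−¼p²}` into `e^{−(k+¼)p²}` for every `k`. [cite: Balaban1985UV3, (41) p.266 and (71) p.273] -/
theorem numeratorBound_selfImproves {b₀ p₀ ε₀ C68 Cχ B₃ : ℝ}
    (E : (K j : ℕ) → Plaq (F.P K) j → Set (GaugeField (F.P K) j (Matrix.specialUnitaryGroup (Fin 2) ℂ)))
    (B : ℕ → ℕ → ℝ)
    (hall : ∀ (D : AlphaDataT3 F γ) (W : LFData D), AlphaInputsT3ACFull D W b₀ p₀ ε₀ C68 Cχ B₃ →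
      ∃ (j₀ : ℕ) (C : ℝ) (A : ℕ), 0 ≤ C ∧ ∀ (K j : ℕ), j₀ < j → j ≤ K → ∀ p : Plaq (F.P K) j,
        ∫ V in E K j p, D.up K j V ∂fieldMeasure (F.P K) j (Matrix.specialUnitaryGroup (Fin 2) ℂ) ≤
          C * (F.scheme ℰp γ).β (K - j) ^ A * B K j *
            ∫ V, D.low K j V ∂fieldMeasure (F.P K) j (Matrix.specialUnitaryGroup (Fin 2) ℂ))
    (T : ℕ → ℕ → ℝ) (hT : ∀ K j, 0 ≤ T K j)
    (D : AlphaDataT3 F γ) (W : LFData D) (hD : AlphaInputsT3ACFull D W b₀ p₀ ε₀ C68 Cχ B₃) :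
    ∃ (j₀ : ℕ) (C : ℝ) (A : ℕ), 0 ≤ C ∧ ∀ (K j : ℕ), j₀ < j → j ≤ K → ∀ p : Plaq (F.P K) j,
      ∫ V in E K j p, D.up K j V ∂fieldMeasure (F.P K) j (Matrix.specialUnitaryGroup (Fin 2) ℂ) ≤
        C * (F.scheme ℰp γ).β (K - j) ^ A * (Real.exp (-(T K j)) * B K j) *
          ∫ V, D.low K j V ∂fieldMeasure (F.P K) j (Matrix.specialUnitaryGroup (Fin 2) ℂ) := by
  obtain ⟨j₀, C, A, hC, hb⟩ := hall _ _ (alphaInputsT3ACFull_zshift hD T hT)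
  refine ⟨j₀, C, A, hC, fun K j hj hjK p => ?_⟩
  have h := hb K j hj hjK p
  -- the shifted numerator is `e^{T}` times the original one, the denominator is unchanged
  have hnum : ∫ V in E K j p, AlphaDataT3.up ({ D with Zterm := fun K j h => D.Zterm K j h + T K j } : AlphaDataT3 F γ) K j V
        ∂fieldMeasure (F.P K) j (Matrix.specialUnitaryGroup (Fin 2) ℂ) =
      Real.exp (T K j) * ∫ V in E K j p, D.up K j V ∂fieldMeasure (F.P K) j (Matrix.specialUnitaryGroup (Fin 2) ℂ) := by
    rw [up_zshift_eq D W hD.2.1 T K j, integral_const_mul]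
  have hden : ∫ V, AlphaDataT3.low ({ D with Zterm := fun K j h => D.Zterm K j h + T K j } : AlphaDataT3 F γ) K j V
        ∂fieldMeasure (F.P K) j (Matrix.specialUnitaryGroup (Fin 2) ℂ) =
      ∫ V, D.low K j V ∂fieldMeasure (F.P K) j (Matrix.specialUnitaryGroup (Fin 2) ℂ) := rfl
  rw [hnum, hden] at h
  have hexp : 0 < Real.exp (T K j) := Real.exp_pos _
  have h' : ∫ V in E K j p, D.up K j V ∂fieldMeasure (F.P K) j (Matrix.specialUnitaryGroup (Fin 2) ℂ) ≤
      C * (F.scheme ℰp γ).β (K - j) ^ A * B K j *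
          (∫ V, D.low K j V ∂fieldMeasure (F.P K) j (Matrix.specialUnitaryGroup (Fin 2) ℂ)) / Real.exp (T K j) :=
    (le_div_iff₀' hexp).mpr h
  calc ∫ V in E K j p, D.up K j V ∂fieldMeasure (F.P K) j (Matrix.specialUnitaryGroup (Fin 2) ℂ)
      ≤ C * (F.scheme ℰp γ).β (K - j) ^ A * B K j *
          (∫ V, D.low K j V ∂fieldMeasure (F.P K) j (Matrix.specialUnitaryGroup (Fin 2) ℂ)) / Real.exp (T K j) := h'
    _ = C * (F.scheme ℰp γ).β (K - j) ^ A * (Real.exp (-(T K j)) * B K j) *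
          ∫ V, D.low K j V ∂fieldMeasure (F.P K) j (Matrix.specialUnitaryGroup (Fin 2) ℂ) := by
        rw [Real.exp_neg]
        field_simp

end Summit.QuantumFields.YangMills.Theorems.HistoryTailAlphaFreeDial

end
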